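import Summits.CriticalPhenomena.PercolationContinuityZ3.Theorems.Transplant.SkelSignDropAssembly
import Summits.CriticalPhenomena.PercolationContinuityZ3.Theorems.Transplant.SkelPhiStepINegPairs
import Summits.CriticalPhenomena.PercolationContinuityZ3.Theorems.Transplant.PlanarSkeletonNeg1
import HarnessLib

/-!
# N1 (the {±1} node): THE CLOSURE TOP OF RECORD — `PlanarSkeletonNeg.samePDropOfSkeletonNeg₁_of_stepI_run`: the single-type target
# `SamePDropOfSkeletonNeg₁` follows once, for every one-type `PlanarSkeletonNeg Φ` of subexponential growth at a density `0 < p < 1` with Φ2, a.s.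
# uniqueness and `θ_t(p) > 0`, the LEVEL-1 side returns — from the Step-I″ record `D : StepI.DataN` (with its facts) — admissible finite lists
# `Sz`, `SMn` and, at every `q ∈ [p/2, p]` where the Step-I″ family over `StepI.indexNP {t} Sz SMn` holds with accuracy `δI` under Φ2, a run-restricted
# anchored-cells scheme rooted at `t` at density `q` with `KitAtRun`

What this file fixes for the LEVEL-1 seats (run records p1, cells/(R) p2, kit adapter/(F) hp-8·p1, (C) p5, params stmt): the EXACT hypothesis `h` below is
the obligation their residues jointly discharge (twin of D″'s `samePDropOfSkeletonSign₁_of_stepI_run_centred`, with `StepI.DataN/eventN/edgesN/indexNP`,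
no base-position normalisation — LEVEL 0 is written relative to `t` — and no flip).  Ingredients: the node reduction `samePDropOfSkeletonNeg₁_of_subexponential_case'`
(p266489), Step I″ `StepI.exists_stepI_neg_indexP`, and the structure-free drop engine `Skelφ.exists_drop_of_inputs_run'`.
builds on p205010 (kernel theorem, internal audit signed; external expert review pending) — nothing here uses p205010; the node `SamePDropOfSkeletonNeg₁`
stays OPEN: this is a conditional assembly, its hypothesis is not discharged here.  Lane `prim-bschramm`, seat `prim-bschramm-p3` (gen 8; design owner);
helper file (`--supports stmt-CriticalPhenomena-4575`); NEG-SCOPE §3/§5.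
[cite: KozmaNitzan2024, §1 p. 2 (approach 1); §4 Theorem 6 (pp. 25–31), p. 17] [cite: MartineauTassion2017, §3.3 Lemma 3.7, §3.4] [cite: LyonsPeres2016, Thm. 7.6]
-/

noncomputable section

open MeasureTheory ProbabilityTheory
open scoped ENNReal Classical

namespace Summit.CriticalPhenomena.PercolationContinuityZ3.Theorems.Transplant

open Literature.Probability.Percolation Literature.Probability.LatticeModels SimpleGraph KNCells KNLevels
open Literature.Barriers.CriticalPhenomena (IsQuasiTransitive IsGraphAmenable HasExponentialGrowth hasExponentialGrowth_of_not_isGraphAmenable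
  BurtonKeane1989_atMostOneInfiniteCluster_holds countable_of_connected_of_locallyFinite)

namespace PlanarSkeletonNeg

variable {V : Type} {G : SimpleGraph V} [G.LocallyFinite]

/-- **A.s. uniqueness at every density** on a `PlanarSkeletonNeg` graph of subexponential growth (connected by (ι)+(κ), quasi-transitive by the frames, amenable by
the growth hypothesis; Burton–Keane). [cite: LyonsPeres2016, Thm. 7.6] -/
theorem numInfiniteClusters_le_one_neg (Φ : PlanarSkeletonNeg G) (hG : ¬ HasExponentialGrowth G) {t : V} (ht : t ∈ Φ.types) (p : unitInterval) :
    ∀ᵐ ω ∂(bondPercolation G p), numInfiniteClusters ω ≤ 1 := by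
  have hq : IsQuasiTransitive G := Φ.isQuasiTransitive
  have ha : IsGraphAmenable G := by_contra fun hna => hG (hasExponentialGrowth_of_not_isGraphAmenable G hq hna)
  have _ := ht
  exact BurtonKeane1989_atMostOneInfiniteCluster_holds G (Φ.graph_connected t) hq ha p

/-- **THE CLOSURE TOP OF THE {±1} NODE (single type).**  Suppose that for every locally finite `G` NOT of exponential growth with a one-type `PlanarSkeletonNeg Φ`
(`Φ.types = {t}`), every `0 < p < 1` with a.s. uniqueness, Φ2 (`hC`) and `θ_t(p) > 0`, the instance names `0 < δI < 1` and `m₀`; receives a Step-I″ record `D`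
with its facts (`m₀ ≤ k`, `1 ≤ k ≤ M₀`, `R = ψ`, `Λ = fatSeq`, the geometric clause at every admissible `(M, n)`); returns admissible finite lists `Sz`, `SMn`
and, at every `q ∈ [p/2, p]` where the Step-I″ family over `StepI.indexNP {t} Sz SMn` holds with accuracy `δI` under Φ2, a run-restricted anchored-cells scheme
rooted at `t` at density `q` with `KitAtRun`.  Then `SamePDropOfSkeletonNeg₁`. [cite: KozmaNitzan2024, §1 p. 2 (approach 1); §4 Theorem 6 (pp. 25–31), p. 17] -/
theorem samePDropOfSkeletonNeg₁_of_stepI_run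
    (h : ∀ {V : Type} [DecidableEq V] [Countable V] (G : SimpleGraph V) [G.LocallyFinite] (Φ : PlanarSkeletonNeg G),
      ¬ HasExponentialGrowth G → ∀ t ∈ Φ.types, Φ.types = {t} → ∀ p : unitInterval, 0 < (p : ℝ) → (p : ℝ) < 1 →
        (∀ᵐ ω ∂bondPercolation G p, numInfiniteClusters ω ≤ 1) → ∀ hC : Φ.CylSubcritical p, 0 < theta G t p →
          ∃ (δI : ℝ) (m₀ : ℕ), 0 < δI ∧ δI < 1 ∧
            ∀ D : Skelφ.StepI.DataN V, m₀ ≤ D.k → 1 ≤ D.k → D.k ≤ D.M₀ → D.R = Skelφ.fatRadius Φ.frame hC →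
              D.Λ = Skelφ.fatSeq Φ.frame hC → (∀ M, D.M₀ ≤ M → ∀ n, D.n₁ M ≤ n → D.EqGeom G Φ.φ t M n) →
              ∃ (Sz : Finset ℕ) (SMn : Finset (ℕ × ℕ)), (∀ M ∈ Sz, D.M₀ ≤ M) ∧ (∀ q ∈ SMn, D.M₀ ≤ q.1 ∧ D.n₁ q.1 ≤ q.2) ∧
                ∀ q : unitInterval, (p : ℝ) / 2 ≤ q → (q : ℝ) ≤ p →
                  (∀ i ∈ Skelφ.StepI.indexNP {t} Sz SMn,
                    1 - δI < (bondPercolation G q).real (Skelφ.StepI.eventN G Φ.φ D i)) →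
                  Φ.CylSubcritical q →
                    ∃ (A : Type) (S : KSchA V A) (FD : FaceData V A) (LD : LevelData V A) (ε' δ₂ : ℝ),
                      S.Γ.root = t ∧ S.p = q ∧
                      RunGeom G S.Γ ∧ AnchGeom S.Γ ∧ SepGeom₂ G S.Γ ∧ ExitGeom G S.Γ ∧ StepsGeom S.Γ FD ∧ LevelGeom G S.Γ FD LD ∧
                      S.δc ≤ 1 ∧ 0 ≤ ε' ∧ δ₂ ≤ 1 ∧ 4 * ((1 - δ₂) ^ S.Γ.K + ε') ≤ (1 / 2) ^ 32 ∧
                      KSchA.KitAtRun G S FD δ₂ ε') :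
    SamePDropOfSkeletonNeg₁ := by
  refine samePDropOfSkeletonNeg₁_of_subexponential_case' fun {V} G _ Φ hg t ht h1 hC => ?_
  haveI : Countable V := countable_of_connected_of_locallyFinite G (Φ.graph_connected t) t
  refine theta_criticalProbIOf_eq_zero_of_drop_at G t fun hθ => ?_
  have hp0 : 0 < ((criticalProbIOf G t : unitInterval) : ℝ) := PlanarSkeletonSign.pos_of_theta_pos hθ
  have hp1 : ((criticalProbIOf G t : unitInterval) : ℝ) < 1 := Φ.criticalProb_lt_one t
  have hU := Φ.numInfiniteClusters_le_one_neg hg ht (criticalProbIOf G t)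
  obtain ⟨δI, m₀, hδI, hδI1, hB⟩ := h G Φ hg t ht h1 _ hp0 hp1 hU hC hθ
  have hC' : Skelφ.CylSubcritical G Φ.φ Φ.types (criticalProbIOf G t) := (Φ.cylSubcritical_iff_skelφ _).1 hC
  -- Step I″ for the (single) type at `p_c`
  obtain ⟨D, hk₀, hk₁, hkM, hR, hΛ, hgeom, hfam⟩ :=
    Skelφ.StepI.exists_stepI_neg_indexP (types := Φ.types) (Φ.graph_connected t).preconnected Φ.lip_skelφ Φ.steps_skelφ Φ.frames_skelφ
      Φ.cylConn_skelφ hC' hp0 hp1 hU hθ Φ.neg hδI hδI1 m₀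
  obtain ⟨Sz, SMn, hSz, hSMn, hq⟩ := hB D hk₀ hk₁ hkM hR hΛ (fun M hM n hn => hgeom t ht M hM n hn)
  -- the structure-free pointwise drop with (A) := the Step-I″ family over the pairs index set
  have hfam' := hfam Sz SMn hSz hSMn
  rw [h1] at hfam'
  exact Skelφ.exists_drop_of_inputs_run' (φ := Φ.φ) (types := Φ.types) t hp0 hC'
    (Skelφ.StepI.indexNP {t} Sz SMn) (Skelφ.StepI.eventN G Φ.φ D) (Skelφ.StepI.edgesN G Φ.φ D) (fun _ => 1 - δI)
    (fun i _ => Skelφ.StepI.determinedBy_eventN G Φ.φ D i) hfam'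
    fun q hq1 hq2 hcq hCq => hq q hq1 hq2 hcq ((Φ.cylSubcritical_iff_skelφ q).2 hCq)

end PlanarSkeletonNeg

end Summit.CriticalPhenomena.PercolationContinuityZ3.Theorems.Transplant

end
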